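import Mathlib
import Summits.KontsevichZagierPeriods.KontsevichZagierPeriods.Theses.SymplecticScissors

/-!
# Sketch — crux-ideate stmt-KontsevichZagierPeriods-10058 (`PlanarCompiler`), ideator 1

First-lemma signatures of the two crux ideas of ideator 1 (round 1):
* `marginal-calculus`: `PlanarCavalieri`, `CellAdditivity`, `GreenAsMarginals`, `BandCoupling`;
* `measure-preserving-coupling`: `MeasurePreservingMove`, `RectangleIdentity`, `CouplingPreservesMeasure`;
gen-2 additions (remarks (i)/(ii) of `marginal-calculus`): `FlatLocusGeneric`, `SquarePullback`.
Statements only (`def … : Prop`), no proofs claimed; `planarGroup` is checked `rfl`-equal to the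
crux's conclusion subgroup and `PlanarCompiler = (RealOnePeriodRelations → PlanarK0Injective)`.
-/

noncomputable section

set_option linter.dupNamespace false

open MeasureTheory Set Literature.NumberTheory.Transcendental
open Summit.KontsevichZagierPeriods.KontsevichZagierPeriods.Theses.SymplecticScissors

namespace Summit.KontsevichZagierPeriods.KontsevichZagierPeriods.Cruxes.PlanarCompiler.Ideator1

/-- The planar set-chain group `G` (conclusion subgroup of the crux). -/
def planarGroup : AddSubgroup KZ.FormalRep :=
  AddSubgroup.closure ((KZ.domainAddRel ∪ KZ.changeOfVariablesRel) ∩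
    (AddSubgroup.closure {x : KZ.FormalRep | ∃ s : KZ.IntegralRep 2,
      (∀ p ∈ s.domain, s.integrand p = 1) ∧ x = KZ.of s} : Set KZ.FormalRep))

/-- The moves 1a, 1b, 2 (all dimensions), `M` of the antecedent. -/
def movesOne : AddSubgroup KZ.FormalRep :=
  AddSubgroup.closure (KZ.domainAddRel ∪ KZ.integrandAddRel ∪ KZ.changeOfVariablesRel)

example : PlanarCompiler = (RealOnePeriodRelations → PlanarK0Injective) := rfl

example : PlanarK0Injective =
    ∀ (r r' : KZ.IntegralRep 2), (∀ p ∈ r.domain, r.integrand p = 1) →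
      (∀ p ∈ r'.domain, r'.integrand p = 1) → r.value = r'.value →
      KZ.of r - KZ.of r' ∈ planarGroup := rfl

/-! ## idea `marginal-calculus` -/

/-- PLANAR CAVALIERI: two planar integrand-1 sets with the same vertical fibre lengths are equal in
`G` (one ℚ-CAD adapted to both; shear each band down by its lower section; stack). -/
def PlanarCavalieri : Prop :=
  ∀ (r r' : KZ.IntegralRep 2), (∀ p ∈ r.domain, r.integrand p = 1) →
    (∀ p ∈ r'.domain, r'.integrand p = 1) →
    (∀ x : ℝ, volume {y : ℝ | (![x, y] : Fin 2 → ℝ) ∈ r.domain} =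
      volume {y : ℝ | (![x, y] : Fin 2 → ℝ) ∈ r'.domain}) →
    KZ.of r - KZ.of r' ∈ planarGroup

/-- CELL ADDITIVITY (arbitrary-integrand form of the route support `StackingShear`). -/
def CellAdditivity : Prop :=
  ∀ (σ : Set ℝ) (f g : ℝ → ℝ) (r r₁ r₂ : KZ.IntegralRep 2),
    (∀ x ∈ σ, 0 ≤ f x) → (∀ x ∈ σ, 0 ≤ g x) →
    r.domain = {p | p 0 ∈ σ ∧ 0 < p 1 ∧ p 1 < f (p 0) + g (p 0)} →
    r₁.domain = {p | p 0 ∈ σ ∧ 0 < p 1 ∧ p 1 < f (p 0)} →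
    r₂.domain = {p | p 0 ∈ σ ∧ 0 < p 1 ∧ p 1 < g (p 0)} →
    (∀ p ∈ r.domain, r.integrand p = 1) → (∀ p ∈ r₁.domain, r₁.integrand p = 1) →
    (∀ p ∈ r₂.domain, r₂.integrand p = 1) →
    KZ.of r - KZ.of r₁ - KZ.of r₂ ∈ planarGroup

/-- GREEN IS A MARGINAL DIFFERENCE: the typed generator `g = [r₀₁] + [r₁₂] − [r₀₂]` is congruent
modulo `M` to `M_B(Δ) − M_A(Δ) = ([rB1] − [rB0]) − ([rA1] − [rA0])` (no hypothesis on `A, B`). -/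
def GreenAsMarginals : Prop :=
  ∀ (A B : (Fin 2 → ℝ) → ℝ) (r₀₁ r₁₂ r₀₂ rA0 rA1 rB0 rB1 : KZ.IntegralRep 1),
    r₀₁.domain = {z | z 0 ∈ Ioo (0 : ℝ) 1} → r₁₂.domain = {z | z 0 ∈ Ioo (0 : ℝ) 1} →
    r₀₂.domain = {z | z 0 ∈ Ioo (0 : ℝ) 1} → rA0.domain = {z | z 0 ∈ Ioo (0 : ℝ) 1} →
    rA1.domain = {z | z 0 ∈ Ioo (0 : ℝ) 1} → rB0.domain = {z | z 0 ∈ Ioo (0 : ℝ) 1} →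
    rB1.domain = {z | z 0 ∈ Ioo (0 : ℝ) 1} →
    (∀ z ∈ r₀₁.domain, r₀₁.integrand z = A ![z 0, 0]) →
    (∀ z ∈ r₁₂.domain, r₁₂.integrand z = B ![1 - z 0, z 0] - A ![1 - z 0, z 0]) →
    (∀ z ∈ r₀₂.domain, r₀₂.integrand z = B ![0, z 0]) →
    (∀ z ∈ rA0.domain, rA0.integrand z = A ![z 0, 0]) →
    (∀ z ∈ rA1.domain, rA1.integrand z = A ![z 0, 1 - z 0]) →
    (∀ z ∈ rB0.domain, rB0.integrand z = B ![0, z 0]) →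
    (∀ z ∈ rB1.domain, rB1.integrand z = B ![1 - z 0, z 0]) →
    KZ.of r₀₁ + KZ.of r₁₂ - KZ.of r₀₂ -
      ((KZ.of rB1 - KZ.of rB0) - (KZ.of rA1 - KZ.of rA0)) ∈ movesOne

/-- BAND COUPLING on one doubly-monotone twist-definite cell (corollary of the route support
`EqualJacobianTransport`, stmt-9852, with `Ψ₁ = (a, A)`, `Ψ₂ = (b, B)`). -/
def BandCoupling : Prop :=
  ∀ (U : Set (Fin 2 → ℝ)) (A B : (Fin 2 → ℝ) → ℝ), IsOpen U →
    Literature.ModelTheory.ExponentialFields.IsSemialgebraic ℚ U →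
    IsSemialgebraicFunOn ℚ U A → IsSemialgebraicFunOn ℚ U B →
    ContDiffOn ℝ 1 A U → ContDiffOn ℝ 1 B U →
    (∀ p ∈ U, fderiv ℝ A p (Pi.single 1 1) = fderiv ℝ B p (Pi.single 0 1)) →
    (∀ p ∈ U, fderiv ℝ A p (Pi.single 1 1) ≠ 0) →
    InjOn (fun p : Fin 2 → ℝ => (![p 0, A p] : Fin 2 → ℝ)) U →
    InjOn (fun p : Fin 2 → ℝ => (![p 1, B p] : Fin 2 → ℝ)) U →
    ∀ (r r' : KZ.IntegralRep 2),
      r.domain = (fun p : Fin 2 → ℝ => (![p 0, A p] : Fin 2 → ℝ)) '' U →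
      r'.domain = (fun p : Fin 2 → ℝ => (![p 1, B p] : Fin 2 → ℝ)) '' U →
      (∀ q ∈ r.domain, r.integrand q = 1) → (∀ q ∈ r'.domain, r'.integrand q = 1) →
      KZ.of r - KZ.of r' ∈ KZ.changeOfVariablesRel

/-- Remark (i), CERTIFICATE FREEDOM made quantitative: perturbing a ℚ-semialgebraic twist `ρ` by
`λ · τ` with `τ` flat only on a set with empty interior, the flat locus `{ρ + λ τ = 0}` has empty
interior for all but finitely many rational `λ` (fibre-dimension count on `{(λ, p) | ρ p + λ τ p = 0}`). -/
def FlatLocusGeneric : Prop :=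
  ∀ (U : Set (Fin 2 → ℝ)) (ρ τ : (Fin 2 → ℝ) → ℝ),
    Literature.ModelTheory.ExponentialFields.IsSemialgebraic ℚ U →
    IsSemialgebraicFunOn ℚ U ρ → IsSemialgebraicFunOn ℚ U τ →
    interior {p | p ∈ U ∧ τ p = 0} = ∅ →
    Set.Finite {l : ℚ | (interior {p | p ∈ U ∧ ρ p + (l : ℝ) * τ p = 0}).Nonempty}

/-- The square-to-triangle map `σ(u, v) = (u, v(1 − u))`. -/
def sqToTri (q : Fin 2 → ℝ) : Fin 2 → ℝ := ![q 0, q 1 * (1 - q 0)]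

/-- Remark (ii), SQUARE PULL-BACK: the pulled-back potential `S ∘ σ` has derivative
`(A∘σ − v·B∘σ) du + (1 − u)·(B∘σ) dv` on the open square (chain rule). -/
def SquarePullback : Prop :=
  ∀ (S A B : (Fin 2 → ℝ) → ℝ),
    (∀ p : Fin 2 → ℝ, 0 < p 0 → 0 < p 1 → p 0 + p 1 < 1 →
      HasFDerivAt S (A p • ContinuousLinearMap.proj (R := ℝ) (φ := fun _ : Fin 2 => ℝ) 0 +
        B p • ContinuousLinearMap.proj (R := ℝ) (φ := fun _ : Fin 2 => ℝ) 1) p) →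
    ∀ q : Fin 2 → ℝ, 0 < q 0 → q 0 < 1 → 0 < q 1 → q 1 < 1 →
      HasFDerivAt (S ∘ sqToTri)
        ((A (sqToTri q) - q 1 * B (sqToTri q)) •
            ContinuousLinearMap.proj (R := ℝ) (φ := fun _ : Fin 2 => ℝ) 0 +
          ((1 - q 0) * B (sqToTri q)) •
            ContinuousLinearMap.proj (R := ℝ) (φ := fun _ : Fin 2 => ℝ) 1) q

/-! ## idea `measure-preserving-coupling` -/

/-- A measure-preserving ℚ-semialgebraic injection of a finite-area open planar ℚ-region is a
planar move (generic smoothness ⇒ `|det| = 1` off a null closed semialgebraic set). -/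
def MeasurePreservingMove : Prop :=
  ∀ (U : Set (Fin 2 → ℝ)) (Φ : (Fin 2 → ℝ) → (Fin 2 → ℝ)), IsOpen U →
    Literature.ModelTheory.ExponentialFields.IsSemialgebraic ℚ U → volume U < ⊤ →
    IsSemialgebraicMapOn ℚ U Φ → InjOn Φ U →
    (∀ s ⊆ U, MeasurableSet s → volume (Φ '' s) = volume s) →
    ∀ (r r' : KZ.IntegralRep 2), r.domain = U → r'.domain = Φ '' U →
      (∀ q ∈ r.domain, r.integrand q = 1) → (∀ q ∈ r'.domain, r'.integrand q = 1) →
      KZ.of r - KZ.of r' ∈ planarGroup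

/-- RECTANGLE IDENTITY for a potential with continuous gradient `(A, B)` (FTC on the four edges). -/
def RectangleIdentity : Prop :=
  ∀ (W : Set (Fin 2 → ℝ)) (S A B : (Fin 2 → ℝ) → ℝ) (a₁ a₂ b₁ b₂ : ℝ), IsOpen W →
    a₁ ≤ a₂ → b₁ ≤ b₂ → {p : Fin 2 → ℝ | p 0 ∈ Icc a₁ a₂ ∧ p 1 ∈ Icc b₁ b₂} ⊆ W →
    ContinuousOn A W → ContinuousOn B W →
    (∀ p ∈ W, HasFDerivAt S (A p • ContinuousLinearMap.proj (R := ℝ) (φ := fun _ : Fin 2 => ℝ) 0 +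
      B p • ContinuousLinearMap.proj (R := ℝ) (φ := fun _ : Fin 2 => ℝ) 1) p) →
    ∫ a in a₁..a₂, (A ![a, b₂] - A ![a, b₁]) = ∫ b in b₁..b₂, (B ![a₂, b] - B ![a₁, b])

/-- THE COUPLING PRESERVES MEASURE on a doubly-monotone rectangle cell (π-system of curvilinear
rectangles + `RectangleIdentity`). -/
def CouplingPreservesMeasure : Prop :=
  ∀ (S A B : (Fin 2 → ℝ) → ℝ) (u v s t : ℝ), u < v → s < t →
    let U : Set (Fin 2 → ℝ) := {p | p 0 ∈ Ioo u v ∧ p 1 ∈ Ioo s t}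
    ContinuousOn A (closure U) → ContinuousOn B (closure U) →
    (∀ p ∈ U, HasFDerivAt S (A p • ContinuousLinearMap.proj (R := ℝ) (φ := fun _ : Fin 2 => ℝ) 0 +
      B p • ContinuousLinearMap.proj (R := ℝ) (φ := fun _ : Fin 2 => ℝ) 1) p) →
    (∀ a ∈ Ioo u v, StrictMonoOn (fun b : ℝ => A ![a, b]) (Icc s t)) →
    (∀ b ∈ Ioo s t, StrictMonoOn (fun a : ℝ => B ![a, b]) (Icc u v)) →
    ∀ Φ : (Fin 2 → ℝ) → (Fin 2 → ℝ),
      (∀ p ∈ U, Φ ![p 0, A p] = ![p 1, B p]) →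
      ∀ E ⊆ (fun p : Fin 2 → ℝ => (![p 0, A p] : Fin 2 → ℝ)) '' U, MeasurableSet E →
        volume (Φ '' E) = volume E

end Summit.KontsevichZagierPeriods.KontsevichZagierPeriods.Cruxes.PlanarCompiler.Ideator1
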